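import Literature.Probability.LatticeModels.AnisotropicPlaneRotatorInfraredFloor
import HarnessLib

/-!
# The thermodynamic limit of the anisotropic infrared floor: torus sum against the Brillouin-zone
# integral, and long-range order of the layered plane rotator (FILS 1978, (4.7)–(4.10))

Topic `Probability/LatticeModels`, namespace `Literature.Probability.LatticeModels.AnisotropicRotator`.
Sequel of `AnisotropicPlaneRotatorInfraredFloor.lean`, where for every even torus `(ℤ/Lℤ)³`, `L ≥ 4`,
the plateau of the plane rotator with direction-dependent couplings `Kᵢ > 0` was bounded below by
`1 − anisoTorusGreen L K`, `anisoTorusGreen L K = L⁻³∑_{k≠0}E_K(2πk/L)⁻¹`,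
`E_K(p) = ∑ᵢKᵢ(1 − cos pᵢ)`. Here the finite-volume sum is compared with the integral
`anisoLatticeGreen K = (2π)⁻³∫_{[-π,π]³}E_K⁻¹` (Fröhlich–Israel–Lieb–Simon's constant `C₀` of (4.7)
for the anisotropic dispersion; finite in `d = 3`), giving the printed passage to the limit
(4.9)–(4.10) ("assuming some regularity on `E_p`") in one-sided form, which is all the floor needs:

* `anisoTorusGreen_le_add_strip` — at fixed `L ≥ 2`,
  `G_{K,L}(0) ≤ G_K(0) + 8C(2π)⁻³∫_{strip_L}E_K⁻¹`, `C = 1 + (∑Kᵢ)π²/(4 minᵢKᵢ)`,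
  `strip_L = {q ∈ [-π,π]³ : some 0 < qᵢ ≤ 2π/L}`. Proof: a mode `k` with no vanishing coordinate
  is compared with the average of `E_K⁻¹` over the half-open box of side `2π/L` adjacent to its
  centred momentum on the side of the origin (there `E_K ≤ E_K(p_k)` coordinatewise by the
  monotonicity of `cos` on `[0,π]`; the boxes are disjoint and lie in the Brillouin zone) — no
  approximation; a mode with vanishing coordinates is compared with its bulk companion (zeros
  replaced by `1`), whose dispersion is at most `C` times larger (Jordan's inequality), at most `8`
  planar modes sharing a companion, and the companions' boxes lie in the strip;
* `tendsto_strip_integral` — `∫_{strip_L}E_K⁻¹ → 0` (absolute continuity of the integral;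
  `vol(strip_L) ≤ 3(2π/L)(2π)²`);
* **`anisoTorusGreen_le_anisoLatticeGreen_add`** — `∀ ε > 0`, eventually in `L`,
  `G_{K,L}(0) ≤ G_K(0) + ε`;
* **`longRangeOrder_aniso`**, **`layered_longRangeOrder_aniso`** — for `Kᵢ > 0` (resp. the layered
  model `(J∥,J∥,J⊥)`, `J∥, J⊥ > 0`) and `ε > 0`, for all large even `L`,
  `L⁻⁶∑_{x,y}⟨cos(θ_x − θ_y)⟩_K ≥ 1 − G_K(0) − ε`: ORIENTATIONAL LONG-RANGE ORDER as soon as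
  `G_K(0) < 1`. Since `G_K(0) ≤ latticeGreen 0 / minᵢKᵢ` (`anisoLatticeGreen_le_of_le`) this contains
  the weakest-coupling statement of `AnisotropicPlaneRotatorLRO.lean`; for the layered model with
  `J⊥ ≪ J∥` the integral grows only like `(2πJ∥)⁻¹log(J∥/J⊥)` (Kennedy–Lieb–Shastry's `E^r_q`;
  the explicit logarithmic bound is not derived in this file), i.e. in temperature units an
  ordering floor `T ≳ 2πJ∥/log(J∥/J⊥)` — the interlayer companion, from below, of the `K5` ceilings
  of the `hubbard-tc` cell. Classical comparison model only.

## References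

* J. Fröhlich, R. Israel, E. H. Lieb, B. Simon, Comm. Math. Phys. 62 (1978) 1–34, §4, (4.6)–(4.10),
  Thms. 4.6–4.7 (Lieb Selecta pp. 211–212, read) [FILS1978].
* S. Friedli, Y. Velenik, *Statistical Mechanics of Lattice Systems*, CUP (2017), §10.4 (reciprocal
  torus), Thm. 10.25 with (10.41)–(10.42) (isotropic Riemann sum) [FriedliVelenikSMLS2017].
* T. Kennedy, E. H. Lieb, B. S. Shastry, J. Stat. Phys. 53 (1988) 1019–1030, eq. (7) [KLS1988JSP].
-/

noncomputable section

open MeasureTheory Set Finset Filter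
open scoped BigOperators Real Topology

namespace Literature.Probability.LatticeModels

namespace AnisotropicRotator

open NVector (anisoDispersion)

variable {L : ℕ}

/-! ### The anisotropic lattice Green function at the origin -/

/-- **The anisotropic lattice Green function at the origin**,
`G_K(0) = (2π)⁻³ ∫_{[-π,π]³} E_K(p)⁻¹ dp`, `E_K(p) = ∑ᵢ Kᵢ(1 − cos pᵢ)` — the constant `C₀` of
Fröhlich–Israel–Lieb–Simon 1978, (4.7), for the anisotropic nearest-neighbour dispersion (for `K ≡ J`
it is `latticeGreen 0 / J`). [cite: FILS1978, §4, (4.7)] -/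
def anisoLatticeGreen (K : Fin 3 → ℝ) : ℝ :=
  (∫ p in brillouin 3, 1 / anisoDispersion K p) / ((2 * π) ^ 3)

/-- For a constant coupling vector, `G_{(J,J,J)}(0) = latticeGreen 0 / J`. [cite: FILS1978, §4, (4.7)] -/
theorem anisoLatticeGreen_const (J : ℝ) :
    anisoLatticeGreen (fun _ => J) = latticeGreen (0 : Site 3) / J := by
  unfold anisoLatticeGreen latticeGreen
  simp_rw [NVector.anisoDispersion_const]
  have h : ∀ p : Fin 3 → ℝ, Real.cos (∑ i, p i * (((0 : Site 3) i : ℤ) : ℝ)) / dispersion p =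
      1 / dispersion p := fun p => by simp
  simp_rw [h]
  rw [div_div, mul_comm ((2 * π) ^ 3), ← div_div]
  congr 1
  rw [← integral_div]
  refine integral_congr_ae (ae_of_all _ fun p => ?_)
  simp only
  rw [div_div, mul_comm]

/-- The anisotropic dispersion is continuous. [cite: FILS1978, §4, (4.7)] -/
theorem continuous_anisoDispersion (K : Fin 3 → ℝ) :
    Continuous fun p : Fin 3 → ℝ => anisoDispersion K p := by
  unfold NVector.anisoDispersion
  fun_prop

/-- Positivity of the free dispersion where the anisotropic one is positive (`K ≥ 0`).
[cite: FILS1978, §4, (4.7)] -/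
theorem dispersion_pos_of_anisoDispersion_pos {K : Fin 3 → ℝ}
    {p : Fin 3 → ℝ} (hE : 0 < anisoDispersion K p) : 0 < dispersion p := by
  by_contra h
  push Not at h
  have h0 : dispersion p = 0 := le_antisymm h (dispersion_nonneg p)
  unfold dispersion at h0
  have hall := (Finset.sum_eq_zero_iff_of_nonneg fun i _ => sub_nonneg.2 (Real.cos_le_one (p i))).1 h0
  have : anisoDispersion K p = 0 := by
    unfold NVector.anisoDispersion
    exact Finset.sum_eq_zero fun i hi => by rw [hall i hi, mul_zero]
  linarith

/-- `E_K(p)⁻¹ ≤ κ⁻¹ε(p)⁻¹` when `κ ≤ Kᵢ` for all `i` (`κ > 0`). [cite: FILS1978, §4, (4.7)] -/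
theorem inv_anisoDispersion_le {K : Fin 3 → ℝ} {κ : ℝ} (hκ : 0 < κ) (hK : ∀ i, κ ≤ K i)
    (p : Fin 3 → ℝ) : 1 / anisoDispersion K p ≤ 1 / κ * (1 / dispersion p) := by
  have hK0 : ∀ i, 0 ≤ K i := fun i => hκ.le.trans (hK i)
  by_cases hE : anisoDispersion K p = 0
  · rw [hE, div_zero]
    exact mul_nonneg (by positivity) (div_nonneg zero_le_one (dispersion_nonneg p))
  · have hEpos : 0 < anisoDispersion K p :=
      lt_of_le_of_ne (NVector.anisoDispersion_nonneg hK0 p) (Ne.symm hE)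
    have hεpos : 0 < dispersion p := dispersion_pos_of_anisoDispersion_pos hEpos
    rw [one_div_mul_one_div]
    exact one_div_le_one_div_of_le (mul_pos hκ hεpos)
      (NVector.mul_dispersion_le_anisoDispersion hK p)

/-- `E_K⁻¹` is integrable on the Brillouin zone `[-π,π]³` when `0 < κ ≤ Kᵢ` (dominated by
`κ⁻¹ε⁻¹`, integrable in `d = 3`: the tree's `integrable_indicator_inv_dispersion`).
[cite: FILS1978, §4, (4.7) (`C₀ < ∞`)] -/
theorem integrableOn_inv_anisoDispersion {K : Fin 3 → ℝ} {κ : ℝ} (hκ : 0 < κ) (hK : ∀ i, κ ≤ K i) :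
    IntegrableOn (fun p : Fin 3 → ℝ => 1 / anisoDispersion K p) (brillouin 3) := by
  have hint : IntegrableOn (fun p : Fin 3 → ℝ => 1 / dispersion p) (brillouin 3) :=
    (integrable_indicator_iff (measurableSet_brillouin 3)).1
      (integrable_indicator_inv_dispersion (d := 3) le_rfl)
  have hK0 : ∀ i, 0 ≤ K i := fun i => hκ.le.trans (hK i)
  refine (hint.const_mul (1 / κ)).mono' ?_ (ae_of_all _ fun p => ?_)
  · exact (measurable_const.div (continuous_anisoDispersion K).measurable).aestronglyMeasurable
  · rw [Real.norm_eq_abs,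
      abs_of_nonneg (div_nonneg zero_le_one (NVector.anisoDispersion_nonneg hK0 p))]
    exact inv_anisoDispersion_le hκ hK p

/-- **The anisotropic lattice Green function is dominated by the isotropic one at the weakest
coupling**: `0 < J ≤ Kᵢ` for all `i` implies `G_K(0) ≤ latticeGreen 0 / J`. [cite: FILS1978, §4, (4.7)] -/
theorem anisoLatticeGreen_le_of_le {K : Fin 3 → ℝ} {J : ℝ} (hJ : 0 < J) (hK : ∀ i, J ≤ K i) :
    anisoLatticeGreen K ≤ latticeGreen (0 : Site 3) / J := by
  rw [← anisoLatticeGreen_const J]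
  unfold anisoLatticeGreen
  refine div_le_div_of_nonneg_right ?_ (by positivity)
  refine setIntegral_mono_on (integrableOn_inv_anisoDispersion hJ hK)
    (integrableOn_inv_anisoDispersion hJ fun _ => le_rfl) (measurableSet_brillouin 3) fun p _ => ?_
  by_cases hE : anisoDispersion K p = 0
  · rw [hE, div_zero]
    exact div_nonneg zero_le_one (NVector.anisoDispersion_nonneg (fun _ => hJ.le) p)
  · have hEpos : 0 < anisoDispersion K p :=
      lt_of_le_of_ne (NVector.anisoDispersion_nonneg (fun i => hJ.le.trans (hK i)) p) (Ne.symm hE)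
    have hεpos := dispersion_pos_of_anisoDispersion_pos hEpos
    refine one_div_le_one_div_of_le ?_ ?_
    · rw [NVector.anisoDispersion_const]; exact mul_pos hJ hεpos
    · rw [NVector.anisoDispersion_const]; exact NVector.mul_dispersion_le_anisoDispersion hK p

/-- The anisotropic lattice Green function is nonnegative for nonnegative couplings.
[cite: FILS1978, §4, (4.7)] -/
theorem anisoLatticeGreen_nonneg {K : Fin 3 → ℝ} (hK : ∀ i, 0 ≤ K i) : 0 ≤ anisoLatticeGreen K :=
  div_nonneg (setIntegral_nonneg (measurableSet_brillouin 3) fun p _ =>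
    div_nonneg zero_le_one (NVector.anisoDispersion_nonneg hK p)) (by positivity)

/-! ### Centred lattice momenta and the one-dimensional cells of the Riemann-sum comparison -/

variable (L) in
/-- The centred representative `p̃ ∈ (-π, π]` of the lattice momentum `2πm/L` of `m ∈ ℤ/Lℤ`:
`2πm/L` if `m ≤ L/2`, else `2πm/L − 2π`. [cite: FriedliVelenikSMLS2017, §10.4 (reciprocal torus)] -/
def cmom [NeZero L] (m : ZMod L) : ℝ :=
  if m.val ≤ L / 2 then 2 * π * (m.val : ℝ) / L else 2 * π * (m.val : ℝ) / L - 2 * π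

/-- `cos p̃ = cos(2πm/L)`. [cite: FriedliVelenikSMLS2017, §10.4] -/
theorem cos_cmom [NeZero L] (m : ZMod L) :
    Real.cos (cmom L m) = Real.cos (2 * π * (m.val : ℝ) / L) := by
  unfold cmom
  split_ifs
  · rfl
  · rw [Real.cos_sub_two_pi]

/-- The anisotropic dispersion at the centred momenta is its value at the lattice momentum.
[cite: FriedliVelenikSMLS2017, §10.4] -/
theorem anisoDispersion_cmom [NeZero L] (K : Fin 3 → ℝ) (k : TorusSite 3 L) :
    anisoDispersion K (fun i => cmom L (k i)) = anisoDispersion K (latticeMomentum L k) := by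
  unfold NVector.anisoDispersion latticeMomentum
  exact Finset.sum_congr rfl fun i _ => by rw [cos_cmom]

/-- `0 ≤ 2πm/L ≤ π` on the first half (`m ≤ L/2`). [cite: FriedliVelenikSMLS2017, §10.4] -/
theorem cmom_mem_of_le [NeZero L] {m : ZMod L} (hm : m.val ≤ L / 2) :
    cmom L m = 2 * π * (m.val : ℝ) / L ∧ 0 ≤ cmom L m ∧ cmom L m ≤ π := by
  have hL : (0 : ℝ) < L := Nat.cast_pos.2 (Nat.pos_of_ne_zero (NeZero.ne L))
  have h1 : cmom L m = 2 * π * (m.val : ℝ) / L := by simp [cmom, hm]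
  refine ⟨h1, ?_, ?_⟩
  · rw [h1]; positivity
  · rw [h1, div_le_iff₀ hL]
    have h2 : 2 * m.val ≤ L := by omega
    have : (2 : ℝ) * (m.val : ℝ) ≤ L := by exact_mod_cast h2
    nlinarith [Real.pi_pos]

/-- `-π < 2πm/L − 2π ≤ -2π/L` on the second half (`m > L/2`). [cite: FriedliVelenikSMLS2017, §10.4] -/
theorem cmom_mem_of_lt [NeZero L] {m : ZMod L} (hm : ¬ m.val ≤ L / 2) :
    cmom L m = 2 * π * (m.val : ℝ) / L - 2 * π ∧ -π < cmom L m ∧ cmom L m + 2 * π / L ≤ 0 := by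
  have hL : (0 : ℝ) < L := Nat.cast_pos.2 (Nat.pos_of_ne_zero (NeZero.ne L))
  have h1 : cmom L m = 2 * π * (m.val : ℝ) / L - 2 * π := by simp [cmom, hm]
  refine ⟨h1, ?_, ?_⟩
  · rw [h1]
    have h2 : (L : ℝ) < 2 * (m.val : ℝ) := by
      have : L < 2 * m.val := by omega
      exact_mod_cast this
    have h3 : π * L < 2 * π * (m.val : ℝ) := by nlinarith [Real.pi_pos]
    have h4 : π < 2 * π * (m.val : ℝ) / L := by rw [lt_div_iff₀ hL]; exact h3
    linarith
  · rw [h1]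
    have h2 : (m.val : ℝ) + 1 ≤ L := by
      have := ZMod.val_lt m
      exact_mod_cast this
    have : 2 * π * (m.val : ℝ) / L + 2 * π / L = 2 * π * ((m.val : ℝ) + 1) / L := by ring
    rw [show 2 * π * (m.val : ℝ) / L - 2 * π + 2 * π / L =
      2 * π * ((m.val : ℝ) + 1) / L - 2 * π by ring, sub_nonpos, div_le_iff₀ hL]
    nlinarith [Real.pi_pos]

/-- `|p̃| ≤ π`. [cite: FriedliVelenikSMLS2017, §10.4] -/
theorem abs_cmom_le [NeZero L] (m : ZMod L) : |cmom L m| ≤ π := by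
  by_cases hm : m.val ≤ L / 2
  · obtain ⟨-, h0, hπ⟩ := cmom_mem_of_le hm
    rw [abs_of_nonneg h0]; exact hπ
  · obtain ⟨-, h0, hπ⟩ := cmom_mem_of_lt hm
    have hL : (0 : ℝ) < 2 * π / L := by
      have : (0 : ℝ) < L := Nat.cast_pos.2 (Nat.pos_of_ne_zero (NeZero.ne L)); positivity
    rw [abs_of_neg (by linarith)]
    linarith

/-- `|p̃| ≥ 2π/L` for `m ≠ 0`. [cite: FriedliVelenikSMLS2017, §10.4] -/
theorem gridStep_le_abs_cmom [NeZero L] {m : ZMod L} (hm : m ≠ 0) : 2 * π / L ≤ |cmom L m| := by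
  have hL : (0 : ℝ) < L := Nat.cast_pos.2 (Nat.pos_of_ne_zero (NeZero.ne L))
  have hval : 1 ≤ m.val := by
    rw [Nat.one_le_iff_ne_zero]; exact (ZMod.val_ne_zero m).2 hm
  by_cases hm2 : m.val ≤ L / 2
  · obtain ⟨h1, h0, -⟩ := cmom_mem_of_le hm2
    rw [abs_of_nonneg h0, h1, div_le_div_iff_of_pos_right hL]
    have : (1 : ℝ) ≤ m.val := by exact_mod_cast hval
    nlinarith [Real.pi_pos]
  · obtain ⟨-, -, hπ⟩ := cmom_mem_of_lt hm2
    have hh : (0 : ℝ) < 2 * π / L := by positivity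
    rw [abs_of_neg (by linarith)]
    linarith

/-- Jordan's bound at a nonzero lattice momentum: `1 − cos(2πm/L) ≥ (2/π²)(2π/L)²` for `m ≠ 0`.
[cite: FriedliVelenikSMLS2017, §10.4] -/
theorem jordan_cmom [NeZero L] {m : ZMod L} (hm : m ≠ 0) :
    2 / π ^ 2 * (2 * π / L) ^ 2 ≤ 1 - Real.cos (cmom L m) := by
  have h1 := Real.cos_le_one_sub_mul_cos_sq (abs_cmom_le (L := L) m)
  have h2 : (2 * π / L) ^ 2 ≤ (cmom L m) ^ 2 := by
    rw [← sq_abs (cmom L m)]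
    exact pow_le_pow_left₀ (by positivity) (gridStep_le_abs_cmom hm) 2
  have h3 : 2 / π ^ 2 * (2 * π / L) ^ 2 ≤ 2 / π ^ 2 * (cmom L m) ^ 2 :=
    mul_le_mul_of_nonneg_left h2 (by positivity)
  linarith

variable (L) in
/-- The one-dimensional cell of the Riemann-sum comparison attached to `m ∈ ℤ/Lℤ`: the half-open
interval of length `2π/L` adjacent to `p̃` ON THE SIDE OF THE ORIGIN (`(p̃ − 2π/L, p̃]` for
`0 < p̃ ≤ π`, `[p̃, p̃ + 2π/L)` for `-π < p̃ < 0`), on which `1 − cos` is at most its value at `p̃`.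
[cite: FriedliVelenikSMLS2017, §10.4 (reciprocal torus)] -/
def cell1 [NeZero L] (m : ZMod L) : Set ℝ :=
  if m.val ≤ L / 2 then Set.Ioc (cmom L m - 2 * π / L) (cmom L m)
  else Set.Ico (cmom L m) (cmom L m + 2 * π / L)

/-- The cells are measurable. [cite: FriedliVelenikSMLS2017, §10.4] -/
theorem measurableSet_cell1 [NeZero L] (m : ZMod L) : MeasurableSet (cell1 L m) := by
  unfold cell1; split_ifs <;> measurability

/-- The cells have length `2π/L`. [cite: FriedliVelenikSMLS2017, §10.4] -/
theorem volume_cell1 [NeZero L] (m : ZMod L) : volume (cell1 L m) = ENNReal.ofReal (2 * π / L) := by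
  unfold cell1
  split_ifs
  · rw [Real.volume_Ioc]; congr 1; ring
  · rw [Real.volume_Ico]; congr 1; ring

/-- For `m ≠ 0` the cell lies in `[-π, π] ∖ {0}`: every point `q` of it has `|q| ≤ π` and `q ≠ 0`,
and `cos p̃ ≤ cos q` (monotonicity of `cos` on `[0, π]`). [cite: FriedliVelenikSMLS2017, §10.4] -/
theorem mem_cell1 [NeZero L] (hL : 2 ≤ L) {m : ZMod L} (hm : m ≠ 0) {q : ℝ} (hq : q ∈ cell1 L m) :
    -π ≤ q ∧ q ≤ π ∧ q ≠ 0 ∧ Real.cos (cmom L m) ≤ Real.cos q := by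
  have hLpos : (0 : ℝ) < L := Nat.cast_pos.2 (by omega)
  have hval : 1 ≤ m.val := by
    rw [Nat.one_le_iff_ne_zero]; exact (ZMod.val_ne_zero m).2 hm
  have hh : (0 : ℝ) < 2 * π / L := by positivity
  unfold cell1 at hq
  by_cases hm2 : m.val ≤ L / 2
  · rw [if_pos hm2] at hq
    obtain ⟨h1, h0, hπ⟩ := cmom_mem_of_le hm2
    obtain ⟨hq1, hq2⟩ := hq
    have hlow : 0 ≤ cmom L m - 2 * π / L := by
      rw [h1, sub_nonneg, div_le_div_iff_of_pos_right hLpos]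
      have : (1 : ℝ) ≤ m.val := by exact_mod_cast hval
      nlinarith [Real.pi_pos]
    have hqpos : 0 < q := lt_of_le_of_lt hlow hq1
    refine ⟨by linarith [Real.pi_pos], hq2.trans hπ, hqpos.ne', ?_⟩
    exact Real.cos_le_cos_of_nonneg_of_le_pi hqpos.le hπ hq2
  · rw [if_neg hm2] at hq
    obtain ⟨h1, hπ, htop⟩ := cmom_mem_of_lt hm2
    obtain ⟨hq1, hq2⟩ := hq
    have hqneg : q < 0 := lt_of_lt_of_le hq2 htop
    refine ⟨by linarith, by linarith [Real.pi_pos], hqneg.ne, ?_⟩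
    rw [← Real.cos_neg (cmom L m), ← Real.cos_neg q]
    exact Real.cos_le_cos_of_nonneg_of_le_pi (by linarith) (by linarith) (by linarith)

/-- Distinct nonzero residues have disjoint cells. [cite: FriedliVelenikSMLS2017, §10.4] -/
theorem disjoint_cell1 [NeZero L] {m m' : ZMod L} (hm : m ≠ 0) (hm' : m' ≠ 0) (hne : m ≠ m') :
    Disjoint (cell1 L m) (cell1 L m') := by
  have hLpos : (0 : ℝ) < L := Nat.cast_pos.2 (Nat.pos_of_ne_zero (NeZero.ne L))
  have hvne : m.val ≠ m'.val := fun h => hne (ZMod.val_injective L h)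
  have hv : 1 ≤ m.val := by rw [Nat.one_le_iff_ne_zero]; exact (ZMod.val_ne_zero m).2 hm
  have hv' : 1 ≤ m'.val := by rw [Nat.one_le_iff_ne_zero]; exact (ZMod.val_ne_zero m').2 hm'
  -- the cells in grid units: first family `((v-1)h, vh]`, second family `[(v-L)h, (v-L+1)h)`
  have key : ∀ {a b : ZMod L}, 1 ≤ a.val → a.val < b.val → ∀ {q : ℝ},
      q ∈ cell1 L a → q ∈ cell1 L b → False := by
    intro a b ha1 hab q ha hb
    have hab1 : (a.val : ℝ) + 1 ≤ b.val := by exact_mod_cast hab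
    have ha1' : (1 : ℝ) ≤ a.val := by exact_mod_cast ha1
    unfold cell1 at ha hb
    by_cases ha2 : a.val ≤ L / 2 <;> by_cases hb2 : b.val ≤ L / 2
    · rw [if_pos ha2] at ha; rw [if_pos hb2] at hb
      obtain ⟨ha3, -, -⟩ := cmom_mem_of_le ha2
      obtain ⟨hb3, -, -⟩ := cmom_mem_of_le hb2
      have h1 : q ≤ 2 * π * (a.val : ℝ) / L := ha3 ▸ ha.2
      have h2 : 2 * π * (b.val : ℝ) / L - 2 * π / L < q := hb3 ▸ hb.1
      have h4 : 2 * π * (b.val : ℝ) / L - 2 * π / L < 2 * π * (a.val : ℝ) / L :=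
        lt_of_lt_of_le h2 h1
      rw [show 2 * π * (b.val : ℝ) / L - 2 * π / L = 2 * π * ((b.val : ℝ) - 1) / L by ring,
        div_lt_div_iff_of_pos_right hLpos] at h4
      nlinarith [Real.pi_pos]
    · rw [if_pos ha2] at ha; rw [if_neg hb2] at hb
      obtain ⟨ha3, -, -⟩ := cmom_mem_of_le ha2
      obtain ⟨-, -, hb3⟩ := cmom_mem_of_lt hb2
      have h1 : 2 * π * (a.val : ℝ) / L - 2 * π / L < q := ha3 ▸ ha.1
      have h0 : 0 ≤ 2 * π * (a.val : ℝ) / L - 2 * π / L := by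
        rw [show 2 * π * (a.val : ℝ) / L - 2 * π / L = 2 * π * ((a.val : ℝ) - 1) / L by ring]
        exact div_nonneg (by nlinarith [Real.pi_pos]) hLpos.le
      have h2 : q < cmom L b + 2 * π / L := hb.2
      linarith
    · omega
    · rw [if_neg ha2] at ha; rw [if_neg hb2] at hb
      obtain ⟨ha3, -, -⟩ := cmom_mem_of_lt ha2
      obtain ⟨hb3, -, -⟩ := cmom_mem_of_lt hb2
      have h1 : q < 2 * π * (a.val : ℝ) / L - 2 * π + 2 * π / L := ha3 ▸ ha.2
      have h2 : 2 * π * (b.val : ℝ) / L - 2 * π ≤ q := hb3 ▸ hb.1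
      have h5 : 2 * π * (b.val : ℝ) / L < 2 * π * ((a.val : ℝ) + 1) / L := by
        have : 2 * π * (a.val : ℝ) / L - 2 * π + 2 * π / L =
            2 * π * ((a.val : ℝ) + 1) / L - 2 * π := by ring
        linarith
      rw [div_lt_div_iff_of_pos_right hLpos] at h5
      nlinarith [Real.pi_pos]
  rw [Set.disjoint_iff]
  intro q ⟨hq, hq'⟩
  rcases lt_or_gt_of_ne hvne with h | h
  · exact key hv h hq hq'
  · exact key hv' h hq' hq

/-- The cell of `m = 1` is `(0, 2π/L]` (`L ≥ 2`). [cite: FriedliVelenikSMLS2017, §10.4] -/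
theorem cell1_one [NeZero L] (hL : 2 ≤ L) : cell1 L (1 : ZMod L) = Set.Ioc 0 (2 * π / L) := by
  have hval : (1 : ZMod L).val = 1 := ZMod.val_one'' (by omega)
  have hle : (1 : ZMod L).val ≤ L / 2 := by rw [hval]; omega
  obtain ⟨h1, -, -⟩ := cmom_mem_of_le hle
  unfold cell1
  rw [if_pos hle, h1, hval]
  simp

/-! ### Three-dimensional cells and the bulk modes -/

variable (L) in
/-- The three-dimensional cell of a mode `k ∈ (ℤ/Lℤ)³`: the product of the one-dimensional cells of
its coordinates (a half-open box of side `2π/L` adjacent to the centred momentum `p̃_k`, on the side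
of the origin in every coordinate). [cite: FriedliVelenikSMLS2017, §10.4 (reciprocal torus)] -/
def cell3 [NeZero L] (k : TorusSite 3 L) : Set (Fin 3 → ℝ) :=
  Set.pi Set.univ fun i => cell1 L (k i)

/-- The cells are measurable. [cite: FriedliVelenikSMLS2017, §10.4] -/
theorem measurableSet_cell3 [NeZero L] (k : TorusSite 3 L) : MeasurableSet (cell3 L k) :=
  MeasurableSet.univ_pi fun i => measurableSet_cell1 (k i)

/-- The cells have volume `(2π/L)³`. [cite: FriedliVelenikSMLS2017, §10.4] -/
theorem volume_real_cell3 [NeZero L] (k : TorusSite 3 L) :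
    volume.real (cell3 L k) = (2 * π / L) ^ 3 := by
  have hL : (0 : ℝ) < L := Nat.cast_pos.2 (Nat.pos_of_ne_zero (NeZero.ne L))
  rw [measureReal_def, cell3, volume_pi_pi]
  simp_rw [volume_cell1]
  rw [Finset.prod_const, Finset.card_univ, Fintype.card_fin, ← ENNReal.ofReal_pow (by positivity),
    ENNReal.toReal_ofReal (by positivity)]

/-- A *bulk* mode (no vanishing coordinate) has its cell inside the Brillouin zone, away from the
coordinate hyperplanes, and the anisotropic dispersion is SMALLER on the cell than at the mode:
for `q ∈ cell3 k`, `0 < E_K(q) ≤ E_K(p_k)` (`K > 0`). [cite: FILS1978, §4, (4.7)] -/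
theorem mem_cell3 [NeZero L] (hL : 2 ≤ L) {K : Fin 3 → ℝ} (hK : ∀ i, 0 < K i) {k : TorusSite 3 L}
    (hk : ∀ i, k i ≠ 0) {q : Fin 3 → ℝ} (hq : q ∈ cell3 L k) :
    q ∈ brillouin 3 ∧ 0 < anisoDispersion K q ∧
      anisoDispersion K q ≤ anisoDispersion K (latticeMomentum L k) := by
  have hc : ∀ i, -π ≤ q i ∧ q i ≤ π ∧ q i ≠ 0 ∧ Real.cos (cmom L (k i)) ≤ Real.cos (q i) :=
    fun i => mem_cell1 hL (hk i) (hq i (Set.mem_univ i))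
  refine ⟨fun i _ => ⟨(hc i).1, (hc i).2.1⟩, ?_, ?_⟩
  · unfold NVector.anisoDispersion
    have h0 : 0 < K 0 * (1 - Real.cos (q 0)) := by
      refine mul_pos (hK 0) (sub_pos.2 ?_)
      obtain ⟨h1, h2, h3, -⟩ := hc 0
      rcases lt_or_gt_of_ne h3 with hneg | hpos
      · rw [← Real.cos_neg, ← Real.cos_zero]
        exact Real.cos_lt_cos_of_nonneg_of_le_pi le_rfl (by linarith) (by linarith)
      · rw [← Real.cos_zero]
        exact Real.cos_lt_cos_of_nonneg_of_le_pi le_rfl h2 hpos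
    refine lt_of_lt_of_le h0 (Finset.single_le_sum (f := fun i => K i * (1 - Real.cos (q i)))
      (fun i _ => mul_nonneg (hK i).le (sub_nonneg.2 (Real.cos_le_one _))) (Finset.mem_univ 0))
  · rw [← anisoDispersion_cmom]
    unfold NVector.anisoDispersion
    exact Finset.sum_le_sum fun i _ => mul_le_mul_of_nonneg_left (by linarith [(hc i).2.2.2]) (hK i).le

/-- Distinct modes have disjoint cells (used for nonzero coordinates). [cite: FriedliVelenikSMLS2017, §10.4] -/
theorem disjoint_cell3 [NeZero L] {k k' : TorusSite 3 L} (hk : ∀ i, k i ≠ 0) (hk' : ∀ i, k' i ≠ 0)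
    (hne : k ≠ k') : Disjoint (cell3 L k) (cell3 L k') := by
  obtain ⟨i, hi⟩ : ∃ i, k i ≠ k' i := by
    by_contra h
    push Not at h
    exact hne (funext h)
  rw [cell3, cell3, Set.disjoint_univ_pi]
  exact ⟨i, disjoint_cell1 (hk i) (hk' i) hi⟩

/-- **The Riemann-sum comparison for one bulk mode**: `(2π/L)³ E_K(p_k)⁻¹ ≤ ∫_{cell3 k} E_K⁻¹`.
[cite: FILS1978, §4, (4.7) and (4.10) (passage to the limit `|Λ| → ∞`)] -/
theorem cell_bound [NeZero L] (hL : 2 ≤ L) {K : Fin 3 → ℝ} (hK : ∀ i, 0 < K i) {k : TorusSite 3 L}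
    (hk : ∀ i, k i ≠ 0) :
    (2 * π / L) ^ 3 * (1 / anisoDispersion K (latticeMomentum L k)) ≤
      ∫ q in cell3 L k, 1 / anisoDispersion K q := by
  obtain ⟨κ, hκ, hκK⟩ : ∃ κ : ℝ, 0 < κ ∧ ∀ i, κ ≤ K i := by
    obtain ⟨i₀, -, hi₀⟩ := Finset.exists_min_image Finset.univ K ⟨(0 : Fin 3), Finset.mem_univ _⟩
    exact ⟨K i₀, hK i₀, fun i => hi₀ i (Finset.mem_univ i)⟩
  have hsub : cell3 L k ⊆ brillouin 3 := fun q hq => (mem_cell3 hL hK hk hq).1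
  have hint : IntegrableOn (fun q : Fin 3 → ℝ => 1 / anisoDispersion K q) (cell3 L k) :=
    (integrableOn_inv_anisoDispersion hκ hκK).mono_set hsub
  calc (2 * π / L) ^ 3 * (1 / anisoDispersion K (latticeMomentum L k))
      = ∫ _ in cell3 L k, 1 / anisoDispersion K (latticeMomentum L k) := by
        rw [setIntegral_const, volume_real_cell3, smul_eq_mul]
    _ ≤ ∫ q in cell3 L k, 1 / anisoDispersion K q := by
        have hfin : volume (cell3 L k) ≠ ⊤ :=
          ((measure_mono hsub).trans_lt (isCompact_brillouin 3).measure_lt_top).ne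
        refine setIntegral_mono_on (integrableOn_const hfin) hint
          (measurableSet_cell3 k) fun q hq => ?_
        obtain ⟨-, hpos, hle⟩ := mem_cell3 hL hK hk hq
        exact one_div_le_one_div_of_le hpos hle

/-- **The bulk modes are bounded by the integral**: with `B = {k : kᵢ ≠ 0 ∀ i}`,
`(2π/L)³ ∑_{k ∈ B} E_K(p_k)⁻¹ ≤ ∫_{[-π,π]³} E_K⁻¹` (cells disjoint, inside the Brillouin zone,
integrand nonnegative). [cite: FILS1978, §4, (4.7) and (4.10)] -/
theorem bulk_sum_le [NeZero L] (hL : 2 ≤ L) {K : Fin 3 → ℝ} (hK : ∀ i, 0 < K i)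
    (B : Finset (TorusSite 3 L)) (hB : ∀ k ∈ B, ∀ i, k i ≠ 0) {U : Set (Fin 3 → ℝ)}
    (hUm : MeasurableSet U) (hU : U ⊆ brillouin 3) (hBU : ∀ k ∈ B, cell3 L k ⊆ U) :
    (2 * π / L) ^ 3 * ∑ k ∈ B, 1 / anisoDispersion K (latticeMomentum L k) ≤
      ∫ q in U, 1 / anisoDispersion K q := by
  obtain ⟨κ, hκ, hκK⟩ : ∃ κ : ℝ, 0 < κ ∧ ∀ i, κ ≤ K i := by
    obtain ⟨i₀, -, hi₀⟩ := Finset.exists_min_image Finset.univ K ⟨(0 : Fin 3), Finset.mem_univ _⟩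
    exact ⟨K i₀, hK i₀, fun i => hi₀ i (Finset.mem_univ i)⟩
  have hintB : IntegrableOn (fun q : Fin 3 → ℝ => 1 / anisoDispersion K q) (brillouin 3) :=
    integrableOn_inv_anisoDispersion hκ hκK
  rw [Finset.mul_sum]
  calc ∑ k ∈ B, (2 * π / L) ^ 3 * (1 / anisoDispersion K (latticeMomentum L k))
      ≤ ∑ k ∈ B, ∫ q in cell3 L k, 1 / anisoDispersion K q :=
        Finset.sum_le_sum fun k hk => cell_bound hL hK (hB k hk)
    _ = ∫ q in ⋃ k ∈ B, cell3 L k, 1 / anisoDispersion K q := by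
        rw [integral_biUnion_finset B (fun k _ => measurableSet_cell3 k)
          (fun k hk k' hk' hne => disjoint_cell3 (hB k hk) (hB k' hk') hne)
          (fun k hk => hintB.mono_set ((hBU k hk).trans hU))]
    _ ≤ ∫ q in U, 1 / anisoDispersion K q := by
        refine setIntegral_mono_set (hintB.mono_set hU)
          (ae_restrict_of_forall_mem hUm fun q _ =>
            div_nonneg zero_le_one (NVector.anisoDispersion_nonneg (fun i => (hK i).le) q))
          (Filter.Eventually.of_forall (Set.iUnion₂_subset fun k hk => hBU k hk))

/-! ### The planar modes: comparison with a neighbouring bulk mode -/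

variable (L) in
/-- The bulk companion of a mode: every vanishing coordinate is replaced by `1`.
[cite: FILS1978, §4, (4.10) (the modes `p ≠ 0`)] -/
def bulkOf [NeZero L] (k : TorusSite 3 L) : TorusSite 3 L := fun i => if k i = 0 then 1 else k i

/-- `1 ≠ 0` in `ℤ/Lℤ` for `L ≥ 2`. [folklore] -/
private theorem one_ne_zero_zmod [NeZero L] (hL : 2 ≤ L) : (1 : ZMod L) ≠ 0 := by
  intro h
  have h1 : (1 : ZMod L).val = 1 := ZMod.val_one'' (by omega)
  rw [h, ZMod.val_zero] at h1
  exact zero_ne_one h1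

/-- The bulk companion has no vanishing coordinate. [cite: FILS1978, §4, (4.10)] -/
theorem bulkOf_ne_zero [NeZero L] (hL : 2 ≤ L) (k : TorusSite 3 L) (i : Fin 3) : bulkOf L k i ≠ 0 := by
  unfold bulkOf
  split_ifs with h
  · exact one_ne_zero_zmod hL
  · exact h

/-- **The dispersion of the bulk companion is comparable**: for `k ≠ 0` and `0 < κ ≤ Kᵢ`,
`E_K(p_{k'}) ≤ (1 + (∑Kᵢ)π²/(4κ))·E_K(p_k)` where `k'` is the bulk companion of `k` (each new
coordinate costs `Kᵢ(1 − cos(2π/L)) ≤ Kᵢ(2π/L)²/2`, while `E_K(p_k) ≥ κ·(2/π²)(2π/L)²` by Jordan's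
inequality at a nonzero coordinate). [cite: FILS1978, §4, (4.7)] -/
theorem anisoDispersion_bulkOf_le [NeZero L] (hL : 2 ≤ L) {K : Fin 3 → ℝ} {κ : ℝ} (hκ : 0 < κ)
    (hK : ∀ i, κ ≤ K i) {k : TorusSite 3 L} (hk : k ≠ 0) :
    anisoDispersion K (latticeMomentum L (bulkOf L k)) ≤
      (1 + (∑ i, K i) * π ^ 2 / (4 * κ)) * anisoDispersion K (latticeMomentum L k) := by
  have hLpos : (0 : ℝ) < L := Nat.cast_pos.2 (by omega)
  have hK0 : ∀ i, 0 ≤ K i := fun i => hκ.le.trans (hK i)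
  set h : ℝ := 2 * π / L with hh
  set S : ℝ := ∑ i, K i with hS
  set E : ℝ := anisoDispersion K (latticeMomentum L k) with hE
  have hS0 : 0 ≤ S := Finset.sum_nonneg fun i _ => hK0 i
  have hval1 : (1 : ZMod L).val = 1 := ZMod.val_one'' (by omega)
  -- termwise: `E(k') ≤ E(k) + S (1 - cos h)`
  have hterm : anisoDispersion K (latticeMomentum L (bulkOf L k)) ≤ E + S * (1 - Real.cos h) := by
    rw [hE, hS, Finset.sum_mul]
    unfold NVector.anisoDispersion
    rw [← Finset.sum_add_distrib]
    refine Finset.sum_le_sum fun i _ => ?_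
    unfold latticeMomentum bulkOf
    by_cases hi : k i = 0
    · rw [if_pos hi, hi, ZMod.val_zero, hval1]
      simp only [Nat.cast_zero, mul_zero, zero_div, Real.cos_zero, sub_self, Nat.cast_one,
        mul_one]
      rw [hh]
      linarith
    · rw [if_neg hi]
      have : 0 ≤ K i * (1 - Real.cos h) := mul_nonneg (hK0 i) (sub_nonneg.2 (Real.cos_le_one _))
      linarith
  -- `1 - cos h ≤ h²/2`
  have hcosh : 1 - Real.cos h ≤ h ^ 2 / 2 := by
    have := Real.one_sub_sq_div_two_le_cos (x := h); linarith
  -- `E(k) ≥ κ (2/π²) h²`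
  obtain ⟨j, hj⟩ : ∃ j, k j ≠ 0 := by
    by_contra hall
    push Not at hall
    exact hk (funext hall)
  have hEge : κ * (2 / π ^ 2 * h ^ 2) ≤ E := by
    have h1 : κ * (2 / π ^ 2 * h ^ 2) ≤ K j * (1 - Real.cos (cmom L (k j))) :=
      mul_le_mul (hK j) (jordan_cmom hj) (by positivity) (hK0 j)
    rw [hE, ← anisoDispersion_cmom]
    unfold NVector.anisoDispersion
    exact h1.trans (Finset.single_le_sum (f := fun i => K i * (1 - Real.cos (cmom L (k i))))
      (fun i _ => mul_nonneg (hK0 i) (sub_nonneg.2 (Real.cos_le_one _))) (Finset.mem_univ j))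
  have hh2 : h ^ 2 ≤ π ^ 2 / (2 * κ) * E := by
    rw [div_mul_eq_mul_div, le_div_iff₀ (by positivity)]
    have : κ * (2 / π ^ 2 * h ^ 2) * π ^ 2 = h ^ 2 * (2 * κ) := by
      field_simp
    nlinarith [hEge, Real.pi_pos, sq_nonneg π]
  calc anisoDispersion K (latticeMomentum L (bulkOf L k))
      ≤ E + S * (1 - Real.cos h) := hterm
    _ ≤ E + S * (h ^ 2 / 2) := by nlinarith [hcosh]
    _ ≤ E + S * (π ^ 2 / (2 * κ) * E / 2) := by
        have : S * (h ^ 2 / 2) ≤ S * (π ^ 2 / (2 * κ) * E / 2) :=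
          mul_le_mul_of_nonneg_left (by linarith) hS0
        linarith
    _ = (1 + S * π ^ 2 / (4 * κ)) * E := by
        field_simp
        ring

/-- The reciprocal form: `E_K(p_k)⁻¹ ≤ C·E_K(p_{k'})⁻¹` with `C = 1 + (∑Kᵢ)π²/(4κ)`, `k ≠ 0`.
[cite: FILS1978, §4, (4.7)] -/
theorem inv_anisoDispersion_le_bulkOf [NeZero L] (hL : 2 ≤ L) {K : Fin 3 → ℝ} {κ : ℝ} (hκ : 0 < κ)
    (hK : ∀ i, κ ≤ K i) {k : TorusSite 3 L} (hk : k ≠ 0) :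
    1 / anisoDispersion K (latticeMomentum L k) ≤
      (1 + (∑ i, K i) * π ^ 2 / (4 * κ)) *
        (1 / anisoDispersion K (latticeMomentum L (bulkOf L k))) := by
  have hKpos : ∀ i, 0 < K i := fun i => hκ.trans_le (hK i)
  have hEk : 0 < anisoDispersion K (latticeMomentum L k) :=
    NVector.anisoDispersion_latticeMomentum_pos hKpos hk
  have hEb : 0 < anisoDispersion K (latticeMomentum L (bulkOf L k)) :=
    NVector.anisoDispersion_latticeMomentum_pos hKpos (fun h => by
      have := congr_fun h 0
      exact bulkOf_ne_zero hL k 0 this)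
  have hC : 0 ≤ 1 + (∑ i, K i) * π ^ 2 / (4 * κ) := by
    have : 0 ≤ (∑ i, K i) * π ^ 2 / (4 * κ) :=
      div_nonneg (mul_nonneg (Finset.sum_nonneg fun i _ => (hKpos i).le) (sq_nonneg _)) (by positivity)
    linarith
  have hle := anisoDispersion_bulkOf_le hL hκ hK hk
  rw [mul_one_div, div_le_div_iff₀ hEk hEb, one_mul]
  exact hle

/-- **The planar modes are controlled by the bulk modes adjacent to the coordinate planes**: with
`P = {k ≠ 0 : some kᵢ = 0}` and `B₁ = {k : all kᵢ ≠ 0, some kᵢ = 1}`, for `F ≥ 0`,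
`∑_{k ∈ P} F(k') ≤ 8 ∑_{k ∈ B₁} F(k)` (`k ↦ k'` is injective on each of the `8` zero patterns and
maps `P` into `B₁`). [cite: FILS1978, §4, (4.10)] -/
theorem planar_sum_le [NeZero L] (hL : 2 ≤ L) {F : TorusSite 3 L → ℝ} (hF : ∀ k, 0 ≤ F k) :
    ∑ k ∈ (Finset.univ.erase (0 : TorusSite 3 L)).filter (fun k => ∃ i, k i = 0), F (bulkOf L k) ≤
      8 * ∑ k ∈ Finset.univ.filter (fun k : TorusSite 3 L => (∀ i, k i ≠ 0) ∧ ∃ i, k i = 1), F k := by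
  classical
  set P := (Finset.univ.erase (0 : TorusSite 3 L)).filter (fun k => ∃ i, k i = 0) with hP
  set B₁ := Finset.univ.filter (fun k : TorusSite 3 L => (∀ i, k i ≠ 0) ∧ ∃ i, k i = 1) with hB₁
  set pat : TorusSite 3 L → (Fin 3 → Bool) := fun k i => decide (k i = 0) with hpat
  rw [← Finset.sum_fiberwise P pat (fun k => F (bulkOf L k))]
  have hfib : ∀ s : Fin 3 → Bool, ∑ k ∈ P.filter (fun k => pat k = s), F (bulkOf L k) ≤
      ∑ k ∈ B₁, F k := by
    intro s
    have hinj : Set.InjOn (bulkOf L) ↑(P.filter (fun k => pat k = s)) := by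
      intro k hk k' hk' heq
      rw [Finset.coe_filter] at hk hk'
      have hpk : pat k = pat k' := hk.2.trans hk'.2.symm
      funext i
      have hi := congr_fun heq i
      have hpi := congr_fun hpk i
      simp only [hpat, decide_eq_decide] at hpi
      unfold bulkOf at hi
      by_cases h0 : k i = 0
      · rw [h0, (hpi.1 h0)]
      · have h0' : k' i ≠ 0 := fun h => h0 (hpi.2 h)
        rwa [if_neg h0, if_neg h0'] at hi
    rw [← Finset.sum_image hinj]
    refine Finset.sum_le_sum_of_subset_of_nonneg (fun k' hk' => ?_) (fun k _ _ => hF k)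
    obtain ⟨k, hk, rfl⟩ := Finset.mem_image.1 hk'
    obtain ⟨hkP, -⟩ := Finset.mem_filter.1 hk
    obtain ⟨-, ⟨i, hi⟩⟩ := Finset.mem_filter.1 hkP
    refine Finset.mem_filter.2 ⟨Finset.mem_univ _, fun j => bulkOf_ne_zero hL k j, ⟨i, ?_⟩⟩
    simp [bulkOf, hi]
  calc ∑ s : Fin 3 → Bool, ∑ k ∈ P.filter (fun k => pat k = s), F (bulkOf L k)
      ≤ ∑ _s : Fin 3 → Bool, ∑ k ∈ B₁, F k := Finset.sum_le_sum fun s _ => hfib s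
    _ = 8 * ∑ k ∈ B₁, F k := by
        rw [Finset.sum_const, Finset.card_univ, Fintype.card_fun, Fintype.card_bool,
          Fintype.card_fin, nsmul_eq_mul]
        norm_num

/-! ### The strip near the coordinate planes and the main inequality -/

/-- The union of the three coordinate strips `{q : 0 < qᵢ ≤ 2π/L}` (which contains the cells of
the bulk modes with some `kᵢ = 1`). [cite: FILS1978, §4, (4.10)] -/
def stripSet (L : ℕ) : Set (Fin 3 → ℝ) := {q | ∃ i, q i ∈ Set.Ioc 0 (2 * π / L)}

/-- The strip is measurable. [cite: FILS1978, §4, (4.10)] -/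
theorem measurableSet_stripSet (L : ℕ) : MeasurableSet (stripSet L) := by
  have : stripSet L = ⋃ i : Fin 3, (fun q : Fin 3 → ℝ => q i) ⁻¹' Set.Ioc 0 (2 * π / L) := by
    ext q; simp [stripSet]
  rw [this]
  exact MeasurableSet.iUnion fun i => measurableSet_Ioc.preimage (measurable_pi_apply i)

/-- The cell of a bulk mode with some coordinate equal to `1` lies in the strip.
[cite: FILS1978, §4, (4.10)] -/
theorem cell3_subset_strip [NeZero L] (hL : 2 ≤ L) {k : TorusSite 3 L} (hk : ∃ i, k i = 1) :
    cell3 L k ⊆ stripSet L := by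
  obtain ⟨i, hi⟩ := hk
  intro q hq
  refine ⟨i, ?_⟩
  have h := hq i (Set.mem_univ i)
  dsimp only at h
  rwa [hi, cell1_one hL] at h

/-- **The torus sum against the integral, at fixed `L`**: for `0 < κ ≤ Kᵢ` and `L ≥ 2`,
`G_{K,L}(0) ≤ G_K(0) + 8(1 + (∑Kᵢ)π²/(4κ))(2π)⁻³ ∫_{strip_L ∩ [-π,π]³} E_K⁻¹`
(bulk modes by the cell comparison, planar modes through their bulk companions).
[cite: FILS1978, §4, (4.7) and (4.10)] -/
theorem anisoTorusGreen_le_add_strip [NeZero L] (hL : 2 ≤ L) {K : Fin 3 → ℝ} {κ : ℝ} (hκ : 0 < κ)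
    (hK : ∀ i, κ ≤ K i) :
    anisoTorusGreen L K ≤ anisoLatticeGreen K +
      8 * (1 + (∑ i, K i) * π ^ 2 / (4 * κ)) / (2 * π) ^ 3 *
        ∫ q in stripSet L ∩ brillouin 3, 1 / anisoDispersion K q := by
  classical
  have hLpos : (0 : ℝ) < L := Nat.cast_pos.2 (by omega)
  have hKpos : ∀ i, 0 < K i := fun i => hκ.trans_le (hK i)
  set C : ℝ := 1 + (∑ i, K i) * π ^ 2 / (4 * κ) with hC
  have hC0 : 0 ≤ C := by
    have : 0 ≤ (∑ i, K i) * π ^ 2 / (4 * κ) :=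
      div_nonneg (mul_nonneg (Finset.sum_nonneg fun i _ => (hKpos i).le) (sq_nonneg _)) (by positivity)
    rw [hC]; linarith
  set f : TorusSite 3 L → ℝ := fun k => 1 / anisoDispersion K (latticeMomentum L k) with hf
  have hf0 : ∀ k, 0 ≤ f k := fun k =>
    div_nonneg zero_le_one (NVector.anisoDispersion_nonneg (fun i => (hKpos i).le) _)
  set g : (Fin 3 → ℝ) → ℝ := fun q => 1 / anisoDispersion K q with hg
  set T := Finset.univ.erase (0 : TorusSite 3 L) with hT
  set B := T.filter (fun k => ∀ i, k i ≠ 0) with hB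
  set P := T.filter (fun k => ¬ ∀ i, k i ≠ 0) with hP
  set B₁ := Finset.univ.filter (fun k : TorusSite 3 L => (∀ i, k i ≠ 0) ∧ ∃ i, k i = 1) with hB₁
  have hh3 : (2 * π / L) ^ 3 * (L : ℝ) ^ 3 = (2 * π) ^ 3 := by
    field_simp
  have hhpos : (0 : ℝ) < (2 * π / L) ^ 3 := by positivity
  -- bulk modes
  have hbulk : (2 * π / L) ^ 3 * ∑ k ∈ B, f k ≤ ∫ q in brillouin 3, g q :=
    bulk_sum_le hL hKpos B (fun k hk => (Finset.mem_filter.1 hk).2) (measurableSet_brillouin 3)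
      le_rfl (fun k hk => fun q hq => (mem_cell3 hL hKpos (Finset.mem_filter.1 hk).2 hq).1)
  -- planar modes
  have hP' : P = T.filter (fun k => ∃ i, k i = 0) := by
    rw [hP]; congr 1; ext k; push Not; rfl
  have hplanar : (2 * π / L) ^ 3 * ∑ k ∈ P, f k ≤
      8 * C * ∫ q in stripSet L ∩ brillouin 3, g q := by
    have h1 : ∑ k ∈ P, f k ≤ C * ∑ k ∈ P, f (bulkOf L k) := by
      rw [Finset.mul_sum]
      refine Finset.sum_le_sum fun k hk => ?_
      have hk0 : k ≠ 0 := Finset.ne_of_mem_erase (Finset.mem_filter.1 hk).1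
      exact inv_anisoDispersion_le_bulkOf hL hκ hK hk0
    have h2 : ∑ k ∈ P, f (bulkOf L k) ≤ 8 * ∑ k ∈ B₁, f k := by
      rw [hP']
      exact planar_sum_le hL hf0
    have h3 : (2 * π / L) ^ 3 * ∑ k ∈ B₁, f k ≤ ∫ q in stripSet L ∩ brillouin 3, g q :=
      bulk_sum_le hL hKpos B₁ (fun k hk => (Finset.mem_filter.1 hk).2.1)
        ((measurableSet_stripSet L).inter (measurableSet_brillouin 3)) Set.inter_subset_right
        (fun k hk => Set.subset_inter (cell3_subset_strip hL (Finset.mem_filter.1 hk).2.2)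
          (fun q hq => (mem_cell3 hL hKpos (Finset.mem_filter.1 hk).2.1 hq).1))
    calc (2 * π / L) ^ 3 * ∑ k ∈ P, f k
        ≤ (2 * π / L) ^ 3 * (C * (8 * ∑ k ∈ B₁, f k)) := by
          refine mul_le_mul_of_nonneg_left (h1.trans ?_) hhpos.le
          exact mul_le_mul_of_nonneg_left h2 hC0
      _ = 8 * C * ((2 * π / L) ^ 3 * ∑ k ∈ B₁, f k) := by ring
      _ ≤ 8 * C * ∫ q in stripSet L ∩ brillouin 3, g q :=
          mul_le_mul_of_nonneg_left h3 (by positivity)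
  -- assemble
  have hsplit : ∑ k ∈ T, f k = ∑ k ∈ B, f k + ∑ k ∈ P, f k :=
    (Finset.sum_filter_add_sum_filter_not T (fun k => ∀ i, k i ≠ 0) f).symm
  unfold anisoTorusGreen anisoLatticeGreen
  rw [← hT, ← hf] at *
  show 1 / (L : ℝ) ^ 3 * ∑ k ∈ T, f k ≤ (∫ q in brillouin 3, g q) / (2 * π) ^ 3 +
    8 * C / (2 * π) ^ 3 * ∫ q in stripSet L ∩ brillouin 3, g q
  rw [hsplit]
  have hL3 : (0 : ℝ) < (L : ℝ) ^ 3 := by positivity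
  have h2π : (0 : ℝ) < (2 * π) ^ 3 := by positivity
  -- multiply through by `(2π)³ = (2π/L)³ L³`
  rw [← sub_nonneg]
  have key : 0 ≤ ((∫ q in brillouin 3, g q) - (2 * π / L) ^ 3 * ∑ k ∈ B, f k) +
      (8 * C * (∫ q in stripSet L ∩ brillouin 3, g q) - (2 * π / L) ^ 3 * ∑ k ∈ P, f k) := by
    linarith
  have hrw : (∫ q in brillouin 3, g q) / (2 * π) ^ 3 +
      8 * C / (2 * π) ^ 3 * (∫ q in stripSet L ∩ brillouin 3, g q) -
        1 / (L : ℝ) ^ 3 * (∑ k ∈ B, f k + ∑ k ∈ P, f k) =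
      (((∫ q in brillouin 3, g q) - (2 * π / L) ^ 3 * ∑ k ∈ B, f k) +
        (8 * C * (∫ q in stripSet L ∩ brillouin 3, g q) - (2 * π / L) ^ 3 * ∑ k ∈ P, f k)) /
          (2 * π) ^ 3 := by
    rw [← hh3]
    field_simp
    ring
  rw [hrw]
  exact div_nonneg key h2π.le

/-! ### The strip integral vanishes as `L → ∞` -/

/-- The volume of the strip inside the Brillouin zone tends to `0` as `L → ∞`
(it is at most `3·(2π/L)·(2π)²`). [cite: FILS1978, §4, (4.10) (limit `|Λ| → ∞`)] -/
theorem tendsto_volume_strip :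
    Tendsto (fun L : ℕ => volume (stripSet L ∩ brillouin 3)) atTop (𝓝 0) := by
  -- the coordinate boxes
  set box : ℕ → Fin 3 → Set (Fin 3 → ℝ) := fun L i =>
    Set.Icc (Function.update (fun _ : Fin 3 => -π) i 0)
      (Function.update (fun _ : Fin 3 => π) i (2 * π / L)) with hbox
  have hsub : ∀ L : ℕ, stripSet L ∩ brillouin 3 ⊆ ⋃ i, box L i := by
    intro L q ⟨⟨i, hi⟩, hq⟩
    refine Set.mem_iUnion.2 ⟨i, ?_⟩
    rw [hbox]
    simp only [Set.mem_Icc]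
    constructor
    · intro j
      by_cases hj : j = i
      · subst hj; simp only [Function.update_self]; exact hi.1.le
      · rw [Function.update_of_ne hj]; exact (hq j (Set.mem_univ j)).1
    · intro j
      by_cases hj : j = i
      · subst hj; simp only [Function.update_self]; exact hi.2
      · rw [Function.update_of_ne hj]; exact (hq j (Set.mem_univ j)).2
  have hvol : ∀ (L : ℕ) (i : Fin 3), volume (box L i) =
      ENNReal.ofReal (2 * π / L) * ENNReal.ofReal (2 * π) ^ 2 := by
    intro L i
    rw [hbox]
    simp only
    rw [Real.volume_Icc_pi, ← Finset.prod_erase_mul _ _ (Finset.mem_univ i)]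
    simp only [Function.update_self, sub_zero]
    rw [mul_comm]
    congr 1
    rw [Finset.prod_congr rfl fun j hj => by
      rw [Function.update_of_ne (Finset.ne_of_mem_erase hj),
        Function.update_of_ne (Finset.ne_of_mem_erase hj), show π - -π = 2 * π by ring]]
    rw [Finset.prod_const, Finset.card_erase_of_mem (Finset.mem_univ i), Finset.card_univ,
      Fintype.card_fin]
  have hlim : ∀ i : Fin 3, Tendsto (fun L : ℕ => volume (box L i)) atTop (𝓝 0) := by
    intro i
    simp_rw [hvol]
    have h1 : Tendsto (fun L : ℕ => ENNReal.ofReal (2 * π / L)) atTop (𝓝 0) := by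
      rw [← ENNReal.ofReal_zero]
      exact ENNReal.tendsto_ofReal (tendsto_const_div_atTop_nhds_zero_nat (2 * π))
    have h2 := ENNReal.Tendsto.mul_const h1
      (Or.inr (ENNReal.pow_ne_top ENNReal.ofReal_ne_top : ENNReal.ofReal (2 * π) ^ 2 ≠ ⊤))
    rwa [zero_mul] at h2
  have hsum : Tendsto (fun L : ℕ => ∑ i : Fin 3, volume (box L i)) atTop (𝓝 0) := by
    have := tendsto_finsetSum (Finset.univ : Finset (Fin 3)) fun i _ => hlim i
    rwa [Finset.sum_const_zero] at this
  refine tendsto_of_tendsto_of_tendsto_of_le_of_le tendsto_const_nhds hsum (fun L => bot_le)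
    fun L => ?_
  exact (measure_mono (hsub L)).trans (measure_iUnion_fintype_le _ _)

/-- **The strip integral of `E_K⁻¹` tends to `0`** (absolute continuity of the integral of the
integrable function `E_K⁻¹` on `[-π,π]³`). [cite: FILS1978, §4, (4.7)/(4.10)] -/
theorem tendsto_strip_integral {K : Fin 3 → ℝ} {κ : ℝ} (hκ : 0 < κ) (hK : ∀ i, κ ≤ K i) :
    Tendsto (fun L : ℕ => ∫ q in stripSet L ∩ brillouin 3, 1 / anisoDispersion K q) atTop (𝓝 0) := by
  have hint : Integrable (fun q : Fin 3 → ℝ => 1 / anisoDispersion K q)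
      (volume.restrict (brillouin 3)) := integrableOn_inv_anisoDispersion hκ hK
  have hmeas : Tendsto ((volume.restrict (brillouin 3)) ∘ stripSet) atTop (𝓝 0) := by
    have h := tendsto_volume_strip
    refine (tendsto_congr fun L => ?_).1 h
    simp only [Function.comp]
    rw [Measure.restrict_apply (measurableSet_stripSet L)]
  have h := hint.tendsto_setIntegral_nhds_zero hmeas
  refine (tendsto_congr fun L => ?_).1 h
  rw [Measure.restrict_restrict (measurableSet_stripSet L)]

/-! ### The thermodynamic limit: the torus sum against the integral, and long-range order -/

/-- **`limsup_L G_{K,L}(0) ≤ G_K(0)`** in `ε`-form: for positive couplings and every `ε > 0`, for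
all large `L`, `L⁻³∑_{k≠0}E_K(2πk/L)⁻¹ ≤ (2π)⁻³∫_{[-π,π]³}E_K⁻¹ + ε` (the passage to the limit in
Fröhlich–Israel–Lieb–Simon's (4.9)–(4.10), "assuming some regularity on `E_p`", here by monotone
cells and the vanishing strip). [cite: FILS1978, §4, (4.9)–(4.10)] -/
theorem anisoTorusGreen_le_anisoLatticeGreen_add {K : Fin 3 → ℝ} (hK : ∀ i, 0 < K i) {ε : ℝ}
    (hε : 0 < ε) :
    ∃ L₀ : ℕ, ∀ (L : ℕ) [NeZero L], L₀ ≤ L → anisoTorusGreen L K ≤ anisoLatticeGreen K + ε := by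
  obtain ⟨κ, hκ, hκK⟩ : ∃ κ : ℝ, 0 < κ ∧ ∀ i, κ ≤ K i := by
    obtain ⟨i₀, -, hi₀⟩ := Finset.exists_min_image Finset.univ K ⟨(0 : Fin 3), Finset.mem_univ _⟩
    exact ⟨K i₀, hK i₀, fun i => hi₀ i (Finset.mem_univ i)⟩
  set C : ℝ := 8 * (1 + (∑ i, K i) * π ^ 2 / (4 * κ)) / (2 * π) ^ 3 with hC
  have hC0 : 0 < C := by
    have : 0 ≤ (∑ i, K i) * π ^ 2 / (4 * κ) :=
      div_nonneg (mul_nonneg (Finset.sum_nonneg fun i _ => (hK i).le) (sq_nonneg _)) (by positivity)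
    rw [hC]; positivity
  have hlim := tendsto_strip_integral hκ hκK
  have hev : ∀ᶠ L : ℕ in atTop, ∫ q in stripSet L ∩ brillouin 3, 1 / anisoDispersion K q < ε / C :=
    hlim.eventually (gt_mem_nhds (by positivity))
  obtain ⟨L₁, hL₁⟩ := Filter.eventually_atTop.1 hev
  refine ⟨max L₁ 2, fun L _ hL => ?_⟩
  have hL2 : 2 ≤ L := le_trans (le_max_right _ _) hL
  have h1 := anisoTorusGreen_le_add_strip hL2 hκ hκK
  have h2 := hL₁ L (le_trans (le_max_left _ _) hL)
  have h3 : C * ∫ q in stripSet L ∩ brillouin 3, 1 / anisoDispersion K q ≤ ε := by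
    have := (lt_div_iff₀ hC0).1 h2
    linarith [this]
  rw [hC] at h3
  linarith

/-- **Long-range order of the anisotropic plane rotator below the anisotropic infrared threshold**
(Fröhlich–Israel–Lieb–Simon 1978, (4.9)–(4.10) with Thm. 4.7's `E_p = ∑ᵢKᵢ(1 − cos pᵢ)`): for
positive direction-dependent couplings `K` and every `ε > 0` there is `L₀` such that for all even
`L ≥ 4` with `L ≥ L₀`, `L⁻⁶∑_{x,y}⟨cos(θ_x − θ_y)⟩_K ≥ 1 − G_K(0) − ε`,
`G_K(0) = (2π)⁻³∫_{[-π,π]³}(∑ᵢKᵢ(1 − cos pᵢ))⁻¹dp`. Orientational long-range order whenever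
`G_K(0) < 1`. [cite: FILS1978, §4, (4.9)–(4.10) and Thm. 4.7] -/
theorem longRangeOrder_aniso {K : Fin 3 → ℝ} (hK : ∀ i, 0 < K i) {ε : ℝ} (hε : 0 < ε) :
    ∃ L₀ : ℕ, ∀ (L : ℕ) [NeZero L], L₀ ≤ L → Even L → 4 ≤ L →
      1 - anisoLatticeGreen K - ε ≤ plateau L K := by
  obtain ⟨L₀, hL₀⟩ := anisoTorusGreen_le_anisoLatticeGreen_add hK hε
  refine ⟨L₀, fun L _ hL hLe hL4 => ?_⟩
  have h1 := plateau_ge_anisoTorusGreen L hLe hL4 hK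
  have h2 := hL₀ L hL
  linarith

/-- **The layered classical XY model: long-range order below the ANISOTROPIC threshold** — for
in-plane coupling `J∥ > 0`, interlayer coupling `J⊥ > 0` and every `ε > 0`, for all large even `L`,
`L⁻⁶∑_{x,y}⟨cos(θ_x − θ_y)⟩_{(J∥,J∥,J⊥)} ≥ 1 − G_{(J∥,J∥,J⊥)}(0) − ε` with the anisotropic lattice
Green function `G_{(J∥,J∥,J⊥)}(0) = (2π)⁻³∫[J∥(2 − cos p₁ − cos p₂) + J⊥(1 − cos p₃)]⁻¹dp`
(Kennedy–Lieb–Shastry's `E^r_q`); `G ≤ latticeGreen 0 / J⊥` for `J⊥ ≤ J∥`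
(`anisoLatticeGreen_le_of_le`), and for `J⊥ ≪ J∥` the threshold `G < 1` reads
`J∥ ≳ (2π)⁻¹ log(J∥/J⊥)` (the integral is asymptotic to `(2πJ∥)⁻¹log(J∥/J⊥)`; not evaluated here).
In temperature units (`J = J_phys/T`): an ordering floor whose dependence on the interlayer
coupling is only logarithmic, the companion of the `K5` ceilings of the `hubbard-tc` cell.
[cite: FILS1978, §4, (4.9)–(4.10) and Thm. 4.7] [cite: KLS1988JSP, eq. (7)] -/
theorem layered_longRangeOrder_aniso {Jpar Jperp : ℝ} (hpar : 0 < Jpar) (hperp : 0 < Jperp)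
    {ε : ℝ} (hε : 0 < ε) :
    ∃ L₀ : ℕ, ∀ (L : ℕ) [NeZero L], L₀ ≤ L → Even L → 4 ≤ L →
      1 - anisoLatticeGreen (layeredCoupling Jpar Jperp) - ε ≤
        plateau L (layeredCoupling Jpar Jperp) :=
  longRangeOrder_aniso (fun i => by unfold layeredCoupling; split_ifs <;> assumption) hε

end AnisotropicRotator

end Literature.Probability.LatticeModels
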